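import Summits.Ventures.CertifiedManyBodySolver.Downfold.EmeryGammaOffsetCertB
import HarnessLib

/-!
# THE Γ-OFFSET SLOPE LEVER under `t_ppΔ ≤ 4t_pd²` ALONE: the energy slope of the Γ offset `A(ε) = cA/fsT` of the σ three-band contour, `A′ = α/fsT²`, is strictly INCREASING in the
# energy — the `s = 0` end of the fixed-harmonic lever holds without the `t_pp ≤ |t_pd|` atom

Venture CertifiedManyBodySolver, cell `pub/hubbard-downfold` (stage S1; INFLATION-RULES-3to1-B §B.75 (e)/(f)), seat hubbard-downfold-mod-4 (technique B, g30); namespace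
`Summit.Ventures.CertifiedManyBodySolver.Downfold.Emery`. Sequel of `EmeryFermiScaleHarmonic` (`scaleAlpha`, `fsT`) and of the certificate `EmeryGammaOffsetCertA/B` (`gammaOffsetCert`: 632 integer-weight
products over the ONE atom `Q = 4t_pd² − t_ppΔ`, `L = 4`; kit j340119 of this seat, exact vertex of a 54-column bracket subsystem). Companion of `EmeryFermiScaleHarmonicLever` (whose `s = 0`
end `harm0_cross_eq` uses `{Q, P}`; the `s = 1` end genuinely needs `P`). Everything PROVED (0 sorry). WHAT THIS IS NOT: a statement about any material; `U = 0` one-body kinematics.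

* `gamma_cross_eq`: `4·(fsT(ε₁)²·α(ε₂) − fsT(ε₂)²·α(ε₁)) = (ε₂ − ε₁)·gammaOffsetCert` (`ring`, `t_pp = c + h`, `m = t_pd² − t_pp′ε₂`).
* **`gammaOffset_lever`**: `Δ > 0`, `0 ≤ t_pp′ ≤ t_pp`, `0 < ε₁ < ε₂`, `t_pp′ε₂ < t_pd²`, `t_ppΔ ≤ 4t_pd²` ⇒ `fsT(ε₂)²·α(ε₁) < fsT(ε₁)²·α(ε₂)`; hence (`gammaOffset_slope_strictMono`) `α(ε₁)/fsT(ε₁)² <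
  α(ε₂)/fsT(ε₂)²` — the slope of `cA/fsT` grows with the energy (convexity in the two-point sense), for every pair of fillings.

Sources: three-band model [HybertsenSchluterChristensen1989, Eq. (1)]; [AndersenEtAl1995, §6]; Handelman certificates [folklore] (Handelman, Pacific J. Math. 132 (1988)).
-/

noncomputable section

namespace Summit.Ventures.CertifiedManyBodySolver.Downfold.Emery

open Real Set

set_option maxRecDepth 16384 in
/-- **THE CERTIFICATE IDENTITY** (`t_pp = c + h`, `ε₂ = ε₁ + d`, `m = t_pd² − c·ε₂`; scaled by 4): `4·(fsT₁²·α₂ − fsT₂²·α₁) = d·gammaOffsetCert`. [folklore] -/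
theorem gamma_cross_eq (Δ tpd c h ε₁ d : ℝ) :
    (4 : ℝ) * (fsT Δ tpd (c + h) c ε₁ ^ 2 * scaleAlpha Δ tpd (c + h) c (ε₁ + d) - fsT Δ tpd (c + h) c (ε₁ + d) ^ 2 * scaleAlpha Δ tpd (c + h) c ε₁) =
      d * gammaOffsetCert Δ ε₁ d c h (tpd ^ 2 - c * (ε₁ + d)) (4 * tpd ^ 2 - (c + h) * Δ) := by
  unfold scaleAlpha dfsT fsT fsD fsN cA dcA dfsD dfsN gammaOffsetCert gammaOffsetCertP1 gammaOffsetCertP2 gammaOffsetCertP3 gammaOffsetCertP4 gammaOffsetCertP5 gammaOffsetCertP6 gammaOffsetCertP7 gammaOffsetCertP8 gammaOffsetCertP9 gammaOffsetCertP10 gammaOffsetCertP11 gammaOffsetCertP12 gammaOffsetCertP13 gammaOffsetCertP14 gammaOffsetCertP15 gammaOffsetCertP16 gammaOffsetCertP17 gammaOffsetCertP18 gammaOffsetCertP19 gammaOffsetCertP20 gammaOffsetCertP21 gammaOffsetCertP22 gammaOffsetCertP23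
  ring

/-- **THE Γ-OFFSET SLOPE LEVER** (`Δ > 0`, `0 ≤ t_pp′ ≤ t_pp`, `0 < ε₁ < ε₂`, `t_pp′ε₂ < t_pd²`, `t_ppΔ ≤ 4t_pd²`; no face window, no `t_pp ≤ |t_pd|`):
`fsT(ε₂)²·α(ε₁) < fsT(ε₁)²·α(ε₂)`. [folklore] -/
theorem gammaOffset_lever {Δ tpd tpp c ε₁ ε₂ : ℝ} (hΔ : 0 < Δ) (hc : 0 ≤ c) (hct : c ≤ tpp) (h1 : 0 < ε₁) (h12 : ε₁ < ε₂) (hm : c * ε₂ < tpd ^ 2) (hq : tpp * Δ ≤ 4 * tpd ^ 2) :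
    fsT Δ tpd tpp c ε₂ ^ 2 * scaleAlpha Δ tpd tpp c ε₁ < fsT Δ tpd tpp c ε₁ ^ 2 * scaleAlpha Δ tpd tpp c ε₂ := by
  obtain ⟨d, rfl⟩ : ∃ d, ε₂ = ε₁ + d := ⟨ε₂ - ε₁, by ring⟩
  obtain ⟨h, rfl⟩ : ∃ h, tpp = c + h := ⟨tpp - c, by ring⟩
  have hd : 0 < d := by linarith
  have hh : 0 ≤ h := by linarith
  have hQ : 0 ≤ 4 * tpd ^ 2 - (c + h) * Δ := by linarith
  have hM : 0 < tpd ^ 2 - c * (ε₁ + d) := by linarith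
  have hC := gammaOffsetCert_pos (Δ := Δ) (ε₁ := ε₁) (d := d) (c := c) (h := h) (m := tpd ^ 2 - c * (ε₁ + d)) (Q := 4 * tpd ^ 2 - (c + h) * Δ) hΔ h1 hd.le hc hh hM hQ
  have key := gamma_cross_eq Δ tpd c h ε₁ d
  have hX : 0 < fsT Δ tpd (c + h) c ε₁ ^ 2 * scaleAlpha Δ tpd (c + h) c (ε₁ + d) - fsT Δ tpd (c + h) c (ε₁ + d) ^ 2 * scaleAlpha Δ tpd (c + h) c ε₁ := by
    have : 0 < (4 : ℝ) * (fsT Δ tpd (c + h) c ε₁ ^ 2 * scaleAlpha Δ tpd (c + h) c (ε₁ + d) - fsT Δ tpd (c + h) c (ε₁ + d) ^ 2 * scaleAlpha Δ tpd (c + h) c ε₁) := by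
      rw [key]; exact mul_pos hd hC
    linarith
  linarith

/-- THE SLOPE OF THE Γ OFFSET GROWS WITH THE ENERGY: `α(ε₁)/fsT(ε₁)² < α(ε₂)/fsT(ε₂)²` (`fsT(εᵢ) ≠ 0`; same regime) — `cA/fsT` is convex in the two-point sense. [folklore] -/
theorem gammaOffset_slope_strictMono {Δ tpd tpp c ε₁ ε₂ : ℝ} (hΔ : 0 < Δ) (hc : 0 ≤ c) (hct : c ≤ tpp) (h1 : 0 < ε₁) (h12 : ε₁ < ε₂) (hm : c * ε₂ < tpd ^ 2) (hq : tpp * Δ ≤ 4 * tpd ^ 2)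
    (hT₁ : fsT Δ tpd tpp c ε₁ ≠ 0) (hT₂ : fsT Δ tpd tpp c ε₂ ≠ 0) :
    scaleAlpha Δ tpd tpp c ε₁ / fsT Δ tpd tpp c ε₁ ^ 2 < scaleAlpha Δ tpd tpp c ε₂ / fsT Δ tpd tpp c ε₂ ^ 2 := by
  have h := gammaOffset_lever hΔ hc hct h1 h12 hm hq
  have hp₁ : 0 < fsT Δ tpd tpp c ε₁ ^ 2 := by positivity
  have hp₂ : 0 < fsT Δ tpd tpp c ε₂ ^ 2 := by positivity
  rw [div_lt_div_iff₀ hp₁ hp₂]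
  linarith

end Summit.Ventures.CertifiedManyBodySolver.Downfold.Emery
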